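import Summits.KontsevichZagierPeriods.Zeta5Search.TwoTaleOmega.FormalBarnes
import Summits.KontsevichZagierPeriods.Zeta5Search.Denom.PartialFractions

/-!
# Formal Barnes functionals — partial-fraction DATA of an explicit quotient `N / ∏ (X+k)^{m_k}` (cell `pub-zeta5`, cert-1 gen 4)

HONEST FRAMING: systematic search; recurrence certificates; no irrationality claim unless certified. Pure finite algebra
over `ℚ`; no named fact.

OUR infrastructure (Summit side) for the per-direction instances of the (bmiss)@Ω recurrence (blueprint
`families/tele/RECURRENCE.md` §13.10–13.12, cert lanes). An instance needs the partial-fraction data (`FormalBarnes.PF`) of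
the telescoped function `G = Cert·F(p₀;·)` and of quotients `G/(t+c)²` (legitimacy via the residue criterion); all of these
are quotients `N/D` of a polynomial by a product of linear factors `D = ∏_{k ∈ S} (X + k)^{m k}` with `m k ∈ {1,2}`.
Instead of building such data by chains of `mulLin/divLin` operations, this file gives them in CLOSED FORM once and for all:

* `denom S m = ∏_{k∈S} (X + k)^{m k}` (= `Denom.PartialFractions.Dp` at the pole positions `−k`), `eval_denom`,
  `natDegree_denom`;
* `PF.ofFrac N S m : PF` — polynomial part `N /ₘ D`, simple / double parts the COVER-UP coefficients of the remainder
  `N %ₘ D` (`Denom.PartialFractions.cTop/cLow`, fam-denom's kernel partial fractions with poles of order `≤ 2`);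
* `PF.ofFrac_simple_support ⊆ S`, `PF.ofFrac_double_support ⊆ S`, `PF.natDegree_ofFrac_le : deg poly ≤ deg N`, and the
  value theorem `PF.eval_ofFrac : (ofFrac N S m).eval t = N(t)/D(t)` off the poles.

With `FormalBarnesUnique.PF.eq_of_eval_eq` (Lemma U) any other data with these values coincide with `ofFrac`, so an instance
may introduce `G := PF.ofFrac N_G S_G m_G` and never compute a coefficient.
-/

noncomputable section

open Polynomial Finset
open Summit.KontsevichZagierPeriods.Zeta5Search.Denom.PartialFractions

namespace Summit.KontsevichZagierPeriods.Zeta5Search.FormalBarnes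

/-! ### The denominator `∏ (X + k)^{m k}` -/

/-- Pole positions: the factor `(X + k)`, `k ∈ ℤ`, has its root at `t = −k`. -/
def negZ (k : ℤ) : ℚ := -(k : ℚ)

/-- `k ↦ −k` is injective. -/
theorem negZ_injective : Function.Injective negZ := fun a b h => by
  have : (a : ℚ) = b := neg_injective h
  exact_mod_cast this

/-- The denominator `D_{S,m} = ∏_{k ∈ S} (X + k)^{m k}`. -/
def denom (S : Finset ℤ) (m : ℤ → ℕ) : ℚ[X] := Dp S negZ m

variable (S : Finset ℤ) (m : ℤ → ℕ)

/-- `D_{S,m}` written with `X + k`. -/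
theorem denom_eq : denom S m = ∏ k ∈ S, (X + C (k : ℚ)) ^ m k := by
  unfold denom Dp negZ
  refine prod_congr rfl fun k _ => ?_
  rw [map_neg, sub_neg_eq_add]

/-- `D_{S,m}` is monic. -/
theorem monic_denom : (denom S m).Monic := by
  rw [denom_eq]
  exact monic_prod_of_monic _ _ fun k _ => (monic_X_add_C (k : ℚ)).pow (m k)

/-- Value of the denominator: `D_{S,m}(t) = ∏_{k ∈ S} (t + k)^{m k}`. -/
theorem eval_denom (t : ℚ) : (denom S m).eval t = ∏ k ∈ S, (t + k) ^ m k := by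
  rw [denom_eq, eval_prod]
  refine prod_congr rfl fun k _ => ?_
  rw [eval_pow, eval_add, eval_X, eval_C]

/-- Degree of the denominator: `Σ_{k∈S} m k`. -/
theorem natDegree_denom : (denom S m).natDegree = ∑ k ∈ S, m k := natDegree_Dp

/-- Off the poles the denominator does not vanish. -/
theorem eval_denom_ne_zero {t : ℚ} (ht : ∀ k ∈ S, t + k ≠ 0) : (denom S m).eval t ≠ 0 := by
  rw [eval_denom]
  exact prod_ne_zero_iff.2 fun k hk => pow_ne_zero _ (ht k hk)

namespace PF

variable (N : ℚ[X])

/-- Coefficient of `1/(t+k)` in `N/D_{S,m}`: the cover-up coefficient of the remainder at a simple pole, the derivative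
coefficient at a double pole (`0` off `S`). -/
def sCoef (k : ℤ) : ℚ :=
  if k ∈ S then (if m k = 2 then cLow S negZ m (N %ₘ denom S m) k else cTop S negZ m (N %ₘ denom S m) k) else 0

/-- Coefficient of `1/(t+k)²` in `N/D_{S,m}`: the cover-up coefficient at a double pole (`0` elsewhere). -/
def dCoef (k : ℤ) : ℚ :=
  if k ∈ S then (if m k = 2 then cTop S negZ m (N %ₘ denom S m) k else 0) else 0

/-- **Partial-fraction data of `N / ∏_{k∈S} (X+k)^{m k}`** (closed form: quotient polynomial + cover-up coefficients of the
remainder). -/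
def ofFrac : PF where
  poly := N /ₘ denom S m
  simple := Finsupp.onFinset S (sCoef S m N) (fun k hk => by
    by_contra h; exact hk (by simp [sCoef, h]))
  double := Finsupp.onFinset S (dCoef S m N) (fun k hk => by
    by_contra h; exact hk (by simp [dCoef, h]))

/-- The polynomial part of `ofFrac` is the quotient `N /ₘ D`. -/
theorem ofFrac_poly : (ofFrac S m N).poly = N /ₘ denom S m := rfl

/-- The simple coefficient of `ofFrac` at `k`. -/
theorem ofFrac_simple_apply (k : ℤ) : (ofFrac S m N).simple k = sCoef S m N k := by
  simp [ofFrac, Finsupp.onFinset_apply]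

/-- The double coefficient of `ofFrac` at `k`. -/
theorem ofFrac_double_apply (k : ℤ) : (ofFrac S m N).double k = dCoef S m N k := by
  simp [ofFrac, Finsupp.onFinset_apply]

/-- There is no double part at a point of multiplicity `≠ 2` (in particular off `S`). -/
theorem ofFrac_double_eq_zero {k : ℤ} (hk : ¬ (k ∈ S ∧ m k = 2)) : (ofFrac S m N).double k = 0 := by
  rw [ofFrac_double_apply, dCoef]
  by_cases h1 : k ∈ S
  · have h2 : m k ≠ 2 := fun h2 => hk ⟨h1, h2⟩
    simp [h1, h2]
  · simp [h1]

/-- There is no simple part off `S`. -/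
theorem ofFrac_simple_eq_zero {k : ℤ} (hk : k ∉ S) : (ofFrac S m N).simple k = 0 := by
  rw [ofFrac_simple_apply, sCoef, if_neg hk]

/-- The simple poles of `ofFrac` lie in `S`. -/
theorem ofFrac_simple_support : (ofFrac S m N).simple.support ⊆ S := fun k hk => by
  by_contra h
  exact (Finsupp.mem_support_iff.1 hk) (ofFrac_simple_eq_zero S m N h)

/-- The double poles of `ofFrac` lie in `S`. -/
theorem ofFrac_double_support : (ofFrac S m N).double.support ⊆ S := fun k hk => by
  by_contra h
  exact (Finsupp.mem_support_iff.1 hk) (ofFrac_double_eq_zero S m N fun h' => h h'.1)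

/-- Degree of the polynomial part: `deg (N /ₘ D) ≤ deg N`. -/
theorem natDegree_ofFrac_le : (ofFrac S m N).poly.natDegree ≤ N.natDegree := by
  rw [ofFrac_poly, natDegree_divByMonic N (monic_denom S m)]
  exact Nat.sub_le _ _

/-- Sharper: `deg (N /ₘ D) = deg N − deg D`. -/
theorem natDegree_ofFrac : (ofFrac S m N).poly.natDegree = N.natDegree - ∑ k ∈ S, m k := by
  rw [ofFrac_poly, natDegree_divByMonic N (monic_denom S m), natDegree_denom]

/-- **Value of `ofFrac`**: off the poles, `(ofFrac N S m)(t) = N(t)/D_{S,m}(t)` (multiplicities in `{1,2}`). -/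
theorem eval_ofFrac (hm : ∀ k ∈ S, m k = 1 ∨ m k = 2) {t : ℚ} (ht : ∀ k ∈ S, t + k ≠ 0) :
    (ofFrac S m N).eval t = N.eval t / (denom S m).eval t := by
  set D := denom S m with hD
  set r := N %ₘ D with hr
  set q := N /ₘ D with hq
  have hDm : D.Monic := monic_denom S m
  have hDt : D.eval t ≠ 0 := eval_denom_ne_zero S m ht
  have hNqr : N.eval t = r.eval t + D.eval t * q.eval t := by
    have := congrArg (Polynomial.eval t) (modByMonic_add_div N D)
    rwa [eval_add, eval_mul, eq_comm] at this
  -- the value of the data, as explicit sums over `S`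
  have hev : (ofFrac S m N).eval t
      = q.eval t + ∑ k ∈ S, sCoef S m N k / (t + k) + ∑ k ∈ S, dCoef S m N k / (t + k) ^ 2 := by
    unfold PF.eval
    simp only [ofFrac]
    rw [Finsupp.onFinset_sum _ (fun _ => by simp), Finsupp.onFinset_sum _ (fun _ => by simp)]
  rw [hev]
  by_cases hS : ∑ k ∈ S, m k = 0
  · -- no poles at all: `D = 1`
    have hm0 : ∀ k ∈ S, False := fun k hk => by
      have := sum_eq_zero_iff.1 hS k hk
      rcases hm k hk with h | h <;> omega
    have hS' : S = ∅ := eq_empty_of_forall_notMem fun k hk => hm0 k hk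
    have hD1 : D = 1 := by
      apply Polynomial.eq_one_of_monic_natDegree_zero hDm
      rw [hD, natDegree_denom, hS]
    have hr0 : r = 0 := by rw [hr, hD1, modByMonic_one]
    rw [hNqr, hr0, hD1, hS']
    simp
  · have hD1 : D ≠ 1 := fun h1 => by
      have := natDegree_denom S m
      rw [← hD, h1, natDegree_one] at this
      exact hS this.symm
    have hrdeg : r.natDegree < ∑ k ∈ S, m k := by
      rw [← natDegree_denom S m]; exact natDegree_modByMonic_lt N hDm hD1
    have ht' : ∀ k ∈ S, t ≠ negZ k := fun k hk h => ht k hk (by rw [h, negZ]; ring)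
    have hpf := pf_eval (s := S) (ρ := negZ) (m := m) negZ_injective hm r hrdeg ht'
    -- `Dp S negZ m = D`
    have hDp : (Dp S negZ m).eval t = D.eval t := rfl
    rw [hDp] at hpf
    have hsum : ∑ k ∈ S, sCoef S m N k / (t + k) + ∑ k ∈ S, dCoef S m N k / (t + k) ^ 2
        = ∑ k ∈ S, (cTop S negZ m r k / (t - negZ k) ^ m k + cLow S negZ m r k / (t - negZ k)) := by
      rw [← sum_add_distrib]
      refine sum_congr rfl fun k hk => ?_
      have e : t - negZ k = t + k := by rw [negZ]; ring
      rw [e, sCoef, dCoef, if_pos hk, if_pos hk]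
      rcases hm k hk with h1 | h2
      · have : m k ≠ 2 := by omega
        rw [if_neg this, if_neg this, h1, pow_one, cLow, if_neg this]; ring
      · rw [if_pos h2, if_pos h2, h2]; ring
    rw [add_assoc, hsum, ← hpf, hNqr]
    field_simp
    ring

end PF

end Summit.KontsevichZagierPeriods.Zeta5Search.FormalBarnes
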